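import Summits.CriticalPhenomena.SAWScalingLimit.Theses.SAWDevelopingMap
import Summits.CriticalPhenomena.SAWScalingLimit.Theorems.ObservableToSLE.Negative.TightnessNecessity

/-!
# Route `SAWDevelopingMap`: the assembly frame `Assembly` (item `stmt-CriticalPhenomena-14674`)

`Assembly := NoFoldBound → InteriorFlattening → HexTight → HexTransfer → SAWScalingLimit`
(rev 13 of the route).  Unlike the assembly frames of the sibling routes, this frame does NOT take
the route's two glue cruxes `QCIdentification` (`stmt-CriticalPhenomena-8298`:
`NoFoldBound → InteriorFlattening → HexObservableLimit`) and `ObservableToSLE`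
(`stmt-CriticalPhenomena-10472`: `HexObservableLimit → HexTight → ⟨DCS Conjecture 1 written out⟩`)
as hypotheses, so it is not a pure-logic statement over the route's items.  This file records

* `assembly_of_glue` — the intended proof, CONDITIONAL on the two glue cruxes
  (`fun hK hM hT hX => hX (hObs (hId hK hM) hT)`), so that the item closes in one line once
  `QCIdentification_holds` and `ObservableToSLE_holds` exist;
* `assembly_iff` — the exact logical content of the frame: `Assembly` holds iff the two
  estimates (K), (M) and eventual tightness give DCS Conjecture 1 on the hexagonal lattice
  (`HexConjecture`, verbatim the hypothesis of `HexTransfer`) OR the `δℤ²` statement itself.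
  In particular any derivation `NoFoldBound → InteriorFlattening → HexTight → HexConjecture`
  closes the item (`assembly_iff.mpr`), and nothing short of that disjunction does.

All proofs are propositional logic over the route's declarations; no named fact is used.
-/

namespace Summit.CriticalPhenomena.SAWScalingLimit.Theorems

open Summit.CriticalPhenomena.SAWScalingLimit.Theses.SAWDevelopingMap

/-- **The assembly frame from the two glue cruxes.** `QCIdentification` turns (K) `NoFoldBound`
and (M) `InteriorFlattening` into the first waypoint `HexObservableLimit`; `ObservableToSLE` turns
that waypoint and `HexTight` into DCS Conjecture 1 written out (the hypothesis of `HexTransfer`);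
`HexTransfer` carries it to `SAWScalingLimit`.  This is the route's `closes` term with the two glue
cruxes kept as hypotheses. [folklore] -/
theorem assembly_of_glue (hId : QCIdentification) (hObs : ObservableToSLE) : Assembly := by
  unfold Assembly
  intro hK hM hT hX
  exact hX (hObs (hId hK hM) hT)

/-- **The logical content of the frame**: `Assembly` is equivalent to "(K), (M) and eventual
tightness of the critical hexagonal SAW laws imply DCS Conjecture 1 on the hexagonal lattice or the
`δℤ²` scaling-limit statement" (classically `(P → Q) → Q` is `P ∨ Q`, applied to
`HexTransfer = (HexConjecture → SAWScalingLimit)`). [folklore] -/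
theorem assembly_iff :
    Assembly ↔
      (NoFoldBound → InteriorFlattening → HexTight → HexConjecture ∨ _root_.SAWScalingLimit) := by
  unfold Assembly HexTransfer HexConjecture
  constructor
  · intro h hK hM hT
    refine (Classical.em _).imp id fun hC => ?_
    exact h hK hM hT fun hC' => absurd hC' hC
  · intro h hK hM hT hX
    exact (h hK hM hT).elim hX id

/-! ### The one-step closers from single existing items

Besides the intended pair of glue cruxes (`assembly_of_glue`), the frame is closed outright by
either waypoint route: the second waypoint `HexConjecture` alone (item `stmt-CriticalPhenomena-0808`,
definitionally the conjecture leaf `HexSAWScalingLimit`), the sub-problem statement itself, or the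
route's target `HexObservableLimit` (item `stmt-CriticalPhenomena-14003`) together with the
martingale crux `ObservableToSLE` (item `stmt-CriticalPhenomena-10472`).  Once the corresponding
`_holds` theorems exist, `theorem assembly_proof : Assembly := assembly_of_… …_holds` closes the
item; until then the item is exactly as open as `HexConjecture ∨ SAWScalingLimit` relative to (K),
(M) and `HexTight` (`assembly_iff`). -/

/-- **The frame from the second waypoint alone.** DCS Conjecture 1 on the hexagonal lattice
(`HexConjecture`) is verbatim the hypothesis of the tail crux `HexTransfer`, so it closes the frame
without (K), (M) or tightness. [folklore] -/
theorem assembly_of_hexConjecture (hC : HexConjecture) : Assembly := by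
  unfold Assembly HexTransfer
  unfold HexConjecture at hC
  intro _ _ _ hX
  exact hX hC

/-- **The frame from the sub-problem statement itself**: the `δℤ²` scaling limit moots every
hypothesis of the frame. [folklore] -/
theorem assembly_of_sawScalingLimit (hS : _root_.SAWScalingLimit) : Assembly := by
  unfold Assembly
  intro _ _ _ _
  exact hS

/-- **The frame from the route's target and the martingale crux.** The first waypoint
`HexObservableLimit` (the route's target) replaces (K), (M) and the glue `QCIdentification`;
`ObservableToSLE` and `HexTight` then give DCS Conjecture 1 written out, and `HexTransfer`
concludes. [folklore] -/
theorem assembly_of_target (hW : HexObservableLimit) (hObs : ObservableToSLE) : Assembly := by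
  unfold Assembly
  intro _ _ hT hX
  exact hX (hObs hW hT)

/-! ### The ex-falso closers and the exact content of a refutation

The route's KILL CRITERIA (a certified fold refuting (K) `NoFoldBound`, a bulk Beltrami defect
refuting (M) `InteriorFlattening`, or non-tightness refuting `HexTight`) each close the frame
vacuously: the three closers below complete the table of single landed theorems that settle the
item (`assembly_of_glue`, `assembly_of_target`, `assembly_of_hexConjecture`,
`assembly_of_sawScalingLimit` above being the positive ones).  Conversely `not_assembly_iff`
records what a refutation of the frame would have to establish — (K), (M) and tightness standing
with both DCS Conjecture 1 and the `δℤ²` statement failing — so no finite witness refutes it, and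
`assembly_iff_of_estimates` is the residual goal once the three estimates stand. -/

/-- **Ex-falso closer from a fold.** A refutation of (K) `NoFoldBound` (a certified fold of the
developing map — the route's first kill criterion) closes the frame vacuously. [folklore] -/
theorem assembly_of_not_noFoldBound (h : ¬ NoFoldBound) : Assembly := by
  unfold Assembly
  intro hK
  exact absurd hK h

/-- **Ex-falso closer from a bulk defect.** A refutation of (M) `InteriorFlattening` (a Beltrami
quotient bounded below at all lattice depths — the route's second kill criterion) closes the frame
vacuously. [folklore] -/
theorem assembly_of_not_interiorFlattening (h : ¬ InteriorFlattening) : Assembly := by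
  unfold Assembly
  intro _ hM
  exact absurd hM h

/-- **Ex-falso closer from non-tightness.** A refutation of the eventual tightness `HexTight` of
the critical hexagonal SAW laws closes the frame vacuously (and, by the landed
`not_hexConjecture_of_not_hexTight`, refutes DCS Conjecture 1 as formalised). [folklore] -/
theorem assembly_of_not_hexTight (h : ¬ HexTight) : Assembly := by
  unfold Assembly
  intro _ _ hT
  exact absurd hT h

/-- **The exact content of a refutation of the frame**: `¬ Assembly` holds iff (K), (M) and
eventual tightness all HOLD while both DCS Conjecture 1 on the hexagonal lattice (`HexConjecture`)
and the `δℤ²` statement FAIL — a refutation would decide the summit conjunct negatively with the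
line's estimates standing; no counterexample of finite size can do this. [folklore] -/
theorem not_assembly_iff :
    ¬ Assembly ↔
      (NoFoldBound ∧ InteriorFlattening ∧ HexTight ∧ ¬ HexConjecture ∧ ¬ _root_.SAWScalingLimit) := by
  rw [assembly_iff]
  tauto

/-- **The residual goal with the three estimates standing**: given (K), (M) and `HexTight`, the
frame is exactly "DCS Conjecture 1 on the hexagonal lattice or the `δℤ²` statement" — the joint
content of the glue cruxes `QCIdentification` (stmt-CriticalPhenomena-8298) and `ObservableToSLE`
(stmt-CriticalPhenomena-10472), which give the left disjunct. [folklore] -/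
theorem assembly_iff_of_estimates (hK : NoFoldBound) (hM : InteriorFlattening) (hT : HexTight) :
    Assembly ↔ (HexConjecture ∨ _root_.SAWScalingLimit) := by
  rw [assembly_iff]
  exact ⟨fun h => h hK hM hT, fun h _ _ _ => h⟩


/-- **The frame in one line of route vocabulary**: `Assembly` holds iff EITHER the hexagonal
derivation "(K), (M) and eventual tightness give DCS Conjecture 1 on the hexagonal lattice"
(the joint content of the glue cruxes `QCIdentification`, stmt-CriticalPhenomena-8298, and
`ObservableToSLE`, stmt-CriticalPhenomena-10472) OR the `δℤ²` statement outright.  (From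
`assembly_iff`: if the statement holds both sides do; otherwise the disjunct drops.) [folklore] -/
theorem assembly_iff_hexDerivation_or :
    Assembly ↔
      ((NoFoldBound → InteriorFlattening → HexTight → HexConjecture) ∨ _root_.SAWScalingLimit) := by
  rw [assembly_iff]
  constructor
  · intro h
    refine (Classical.em _root_.SAWScalingLimit).symm.imp (fun hS hK hM hT => ?_) id
    exact (h hK hM hT).resolve_right hS
  · rintro (h | hS) hK hM hT
    · exact Or.inl (h hK hM hT)
    · exact Or.inr hS

/-! ### Given the three estimates the residual content is IDENTIFICATION — tightness is not idle

By the landed structure theorem `hexConjecture_iff_tight_and_identification`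
(`Theorems/ObservableToSLE/Negative/TightnessNecessity.lean`: DCS Conjecture 1 as typed ⇔
`HexTight` ∧ identification of every subsequential weak limit law of the critical hexagonal SAW as
the chordal SLE(8/3) law), the hypothesis `HexTight` of the frame absorbs the tightness half of
`HexConjecture`: with (K), (M) and `HexTight` standing, `Assembly` is exactly "identification OR
the `δℤ²` statement".  Inside the hexagonal programme the item is therefore closed by precisely a
derivation `NoFoldBound → InteriorFlattening → HexTight → Identification` — the composite of the
glue crux `QCIdentification` (stmt-CriticalPhenomena-8298) with the identification half of
`ObservableToSLE` (stmt-CriticalPhenomena-10472, cf. the landed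
`observableToSLE_iff_identification`) — and, short of the `δℤ²` statement itself, by nothing less
(`identification_of_assembly`). -/

section Identification

open Literature.Probability.RandomPlanarGeometry Literature.Probability.RandomPlanarGeometry.SAW
  Literature.Probability.LatticeModels MeasureTheory
open scoped NNReal

/-- **Residual goal = identification.** Given (K), (M) and `HexTight`, the frame `Assembly` holds
iff every subsequential weak limit law of the critical hexagonal SAW (along every hexagonal
endpoint approximation of every Dobrushin domain) is the chordal SLE(8/3) law, OR the `δℤ²`
statement holds: `HexTight` discharges the tightness half of DCS Conjecture 1
(`hexConjecture_iff_tight_and_identification`). [folklore] -/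
theorem assembly_iff_identification_of_estimates (hK : NoFoldBound) (hM : InteriorFlattening)
    (hT : HexTight) :
    Assembly ↔
      ((∀ (D : DobrushinDomain) (a b : ℝ → HexVertex),
          IsEmbEndpointApprox hexGraph hexCenter D a b →
            ∀ μ : Measure (CurveClass ℂ), IsProbabilityMeasure μ →
              IsSubseqLimitLaw (fun δ (γ : HexDomainSAW D.carrier δ (a δ) (b δ)) => γ.curve)
                (fun δ => hexSAWLaw D.carrier δ (a δ) (b δ)) μ →
                IsSLELaw ((8 : ℝ≥0) / 3) D μ) ∨ _root_.SAWScalingLimit) := by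
  rw [assembly_iff_of_estimates hK hM hT,
    _root_.Summit.CriticalPhenomena.SAWScalingLimit.Theorems.ObservableToSLE.Negative.hexConjecture_iff_tight_and_identification]
  exact or_congr ⟨fun h => h.2, fun h => ⟨hT, h⟩⟩ Iff.rfl

/-- **The sharpest closer inside the hexagonal programme.** Any derivation of the identification
of subsequential limits from (K), (M) and `HexTight` closes the frame — the composite
`ObservableToSLE ∘ QCIdentification` with the tightness bookkeeping already done. [folklore] -/
theorem assembly_of_identification
    (h : NoFoldBound → InteriorFlattening → HexTight →
      ∀ (D : DobrushinDomain) (a b : ℝ → HexVertex),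
        IsEmbEndpointApprox hexGraph hexCenter D a b →
          ∀ μ : Measure (CurveClass ℂ), IsProbabilityMeasure μ →
            IsSubseqLimitLaw (fun δ (γ : HexDomainSAW D.carrier δ (a δ) (b δ)) => γ.curve)
              (fun δ => hexSAWLaw D.carrier δ (a δ) (b δ)) μ →
              IsSLELaw ((8 : ℝ≥0) / 3) D μ) :
    Assembly := by
  refine assembly_iff.mpr fun hK hM hT => Or.inl ?_
  exact _root_.Summit.CriticalPhenomena.SAWScalingLimit.Theorems.ObservableToSLE.Negative.hexConjecture_iff_tight_and_identification.mpr
    ⟨hT, h hK hM hT⟩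

/-- **… and nothing less, short of `δℤ²` directly**: if the frame holds while the `δℤ²` statement
is not (yet) available, then (K), (M) and `HexTight` DO identify every subsequential limit law of
the critical hexagonal SAW as chordal SLE(8/3). [folklore] -/
theorem identification_of_assembly (h : Assembly) (hS : ¬ _root_.SAWScalingLimit)
    (hK : NoFoldBound) (hM : InteriorFlattening) (hT : HexTight) :
    ∀ (D : DobrushinDomain) (a b : ℝ → HexVertex),
      IsEmbEndpointApprox hexGraph hexCenter D a b →
        ∀ μ : Measure (CurveClass ℂ), IsProbabilityMeasure μ →
          IsSubseqLimitLaw (fun δ (γ : HexDomainSAW D.carrier δ (a δ) (b δ)) => γ.curve)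
            (fun δ => hexSAWLaw D.carrier δ (a δ) (b δ)) μ →
            IsSLELaw ((8 : ℝ≥0) / 3) D μ :=
  ((assembly_iff_identification_of_estimates hK hM hT).mp h).resolve_right hS

end Identification

end Summit.CriticalPhenomena.SAWScalingLimit.Theorems
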